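import Mathlib
import Summits.NavierStokesRegularity.NavierStokesRegularity.Theorems.EulerZoomLiouvillePowerGaugeEulerLiouvilleSelfSimilarBernoulliLandscape
import HarnessLib

/-!
# «FAST VORTICAL CHANNELS SQUEEZE VOLUME TOO FAST» with no growth hypothesis — tools: crossing times, the logarithmic crossing integral,
# the closed «stay set», and the flow's change of variables along orbits that stay
# (crux `EulerZoomLiouville.PowerGaugeEulerLiouville` = stmt-NavierStokesRegularity-19832, line `birth`, THE ONE STATEMENT; LEAD's RESIDUE-MEMO-19832-g12 target T3)

Route №10 `EulerZoomLiouville` (NavierStokesRegularity); width seat ns-ezl-w5 g2.  Tools for T3d «no upper rate»: the exit set of a blob under the backward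
cut-off similarity flow has small MEASURE.  An orbit that reaches radius `b` from inside radius `a < b` CROSSES the shell `a ≤ ‖z‖ ≤ b` (`Loc.exists_crossing_times`);
along the crossing `log(b/a) = ∫(−⟪Y, W Y⟫/‖Y‖²)dt`, hence `∫(⟪Y, W Y⟫/‖Y‖²)² ≥ log(b/a)²/T` (`Loc.sq_log_le_mul_integral_sq`, FTC + AM–GM); the set of
`(t, y)` whose backward orbit stays in a closed ball on `[0,t]` is CLOSED (`Loc.isClosed_backwardStaySet`, joint continuity of the `C²` flow), so Tonelli applies;
and on orbits that stay where the cut-off field is divergence-free the backward flow pulls Lebesgue measure back with the constant Jacobian `e^{3γt}`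
(`Loc.lintegral_comp_backwardFlow_eq_of_stay`, the function form of the LEAD's `BernoulliLandscape.volume_image_flow_eq_exp_of_stay`).

HONEST LABEL: tools for ONE dynamical sub-stratum of THE ONE STATEMENT.  WHAT THIS IS NOT: not NS, not E — 19832 is a crux CLASS on the MODEL lattice (E/NS
strata) and stays OPEN; NS regularity is NOT proved. [folklore; ConstantinIgnatovaVicol2026Putative §3.4.1 (3.21)–(3.22)]
-/

noncomputable section

-- flat `Theorems/<Route><Decl>…` files of one crux share the namespace of the crux (tree convention)
set_option linter.dupNamespace false

open MeasureTheory Set Filter Topology Metric Function InnerProductSpace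
open scoped RealInnerProductSpace NNReal ENNReal ContDiff

namespace Summit.NavierStokesRegularity.NavierStokesRegularity.Theorems.PowerGaugeEulerLiouville.Loc

open Literature.Analysis Literature.Analysis.FluidPDE
open Summit.NavierStokesRegularity.NavierStokesRegularity.Theorems.PowerGaugeEulerLiouville.BernoulliLandscape

/-! ### Crossing times of a shell -/

/-- **Crossing times.**  A continuous path `Y` with `‖Y 0‖ < a < b` that reaches `‖Y t‖ ≥ b` at some `t ∈ [0,T]` has times `0 ≤ t₁ ≤ t₂ ≤ T` with `‖Y t₁‖ = a`,
`‖Y t₂‖ = b`, `‖Y s‖ ≤ b` on `[0, t₂]` and `a ≤ ‖Y s‖` on `[t₁, t₂]` (first hitting time of `b`, then last time `≤ a` before it). [folklore] -/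
theorem exists_crossing_times {Y : ℝ → EuclideanSpace ℝ (Fin 3)} (hYc : Continuous Y) {a b T : ℝ} (hab : a < b) (h0 : ‖Y 0‖ < a)
    (hexit : ∃ t ∈ Icc 0 T, b ≤ ‖Y t‖) :
    ∃ t₁ t₂ : ℝ, 0 ≤ t₁ ∧ t₁ ≤ t₂ ∧ t₂ ≤ T ∧ ‖Y t₁‖ = a ∧ ‖Y t₂‖ = b ∧
      (∀ s ∈ Icc 0 t₂, ‖Y s‖ ≤ b) ∧ (∀ s ∈ Icc t₁ t₂, a ≤ ‖Y s‖) := by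
  have hnc : Continuous fun t => ‖Y t‖ := hYc.norm
  -- the first hitting time of `b`
  set S₂ : Set ℝ := Icc 0 T ∩ {t | b ≤ ‖Y t‖} with hS₂
  have hS₂c : IsClosed S₂ := isClosed_Icc.inter (isClosed_le continuous_const hnc)
  have hS₂ne : S₂.Nonempty := by obtain ⟨t, ht, hb⟩ := hexit; exact ⟨t, ht, hb⟩
  have hS₂bdd : BddBelow S₂ := ⟨0, fun t ht => ht.1.1⟩
  set t₂ : ℝ := sInf S₂ with ht₂
  have ht₂mem : t₂ ∈ S₂ := hS₂c.csInf_mem hS₂ne hS₂bdd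
  have ht₂le : ∀ t ∈ S₂, t₂ ≤ t := fun t ht => csInf_le hS₂bdd ht
  have ht₂0 : 0 ≤ t₂ := ht₂mem.1.1
  have ht₂T : t₂ ≤ T := ht₂mem.1.2
  have hbefore₂ : ∀ s ∈ Ico 0 t₂, ‖Y s‖ < b := by
    intro s hs
    by_contra hge
    exact absurd (ht₂le s ⟨⟨hs.1, hs.2.le.trans ht₂T⟩, not_lt.1 hge⟩) (not_le.2 hs.2)
  have ht₂pos : 0 < t₂ := by
    rcases eq_or_lt_of_le ht₂0 with h | h
    · exfalso
      have := ht₂mem.2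
      rw [← h] at this
      exact absurd (lt_of_le_of_lt this (h0.trans hab)) (lt_irrefl _)
    · exact h
  have hYt₂ : ‖Y t₂‖ = b := by
    refine le_antisymm ?_ ht₂mem.2
    -- continuity from the left
    by_contra hgt
    push Not at hgt
    obtain ⟨ε, hε, hball⟩ := Metric.continuousAt_iff.1 hnc.continuousAt (‖Y t₂‖ - b) (by linarith)
    set s : ℝ := max 0 (t₂ - ε / 2) with hs
    have hs0 : 0 ≤ s := le_max_left _ _
    have hslt : s < t₂ := max_lt ht₂pos (by linarith)
    have hsd : dist s t₂ < ε := by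
      rw [Real.dist_eq, abs_of_nonpos (by linarith)]
      have : t₂ - ε / 2 ≤ s := le_max_right _ _
      linarith
    have h1 := hball hsd
    rw [Real.dist_eq, abs_lt] at h1
    have h2 := hbefore₂ s ⟨hs0, hslt⟩
    linarith [h1.1]
  -- the last time `≤ a` before `t₂`
  set S₁ : Set ℝ := Icc 0 t₂ ∩ {t | ‖Y t‖ ≤ a} with hS₁
  have hS₁c : IsClosed S₁ := isClosed_Icc.inter (isClosed_le hnc continuous_const)
  have hS₁ne : S₁.Nonempty := ⟨0, ⟨le_rfl, ht₂0⟩, h0.le⟩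
  have hS₁bdd : BddAbove S₁ := ⟨t₂, fun t ht => ht.1.2⟩
  set t₁ : ℝ := sSup S₁ with ht₁
  have ht₁mem : t₁ ∈ S₁ := hS₁c.csSup_mem hS₁ne hS₁bdd
  have ht₁ge : ∀ t ∈ S₁, t ≤ t₁ := fun t ht => le_csSup hS₁bdd ht
  have ht₁0 : 0 ≤ t₁ := ht₁mem.1.1
  have ht₁₂ : t₁ ≤ t₂ := ht₁mem.1.2
  have hafter₁ : ∀ s ∈ Ioc t₁ t₂, a < ‖Y s‖ := by
    intro s hs
    by_contra hle
    exact absurd (ht₁ge s ⟨⟨ht₁0.trans hs.1.le, hs.2⟩, not_lt.1 hle⟩) (not_le.2 hs.1)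
  have ht₁lt : t₁ < t₂ := by
    rcases eq_or_lt_of_le ht₁₂ with h | h
    · exfalso
      have h1 := ht₁mem.2
      have h2 : ‖Y t₁‖ = b := by rw [h]; exact hYt₂
      simp only [mem_setOf_eq] at h1
      linarith
    · exact h
  have hYt₁ : ‖Y t₁‖ = a := by
    refine le_antisymm ht₁mem.2 ?_
    by_contra hlt
    push Not at hlt
    obtain ⟨ε, hε, hball⟩ := Metric.continuousAt_iff.1 hnc.continuousAt (a - ‖Y t₁‖) (by linarith)
    set s : ℝ := min t₂ (t₁ + ε / 2) with hs
    have hst₂ : s ≤ t₂ := min_le_left _ _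
    have hsgt : t₁ < s := lt_min ht₁lt (by linarith)
    have hsd : dist s t₁ < ε := by
      rw [Real.dist_eq, abs_of_nonneg (by linarith)]
      have : s ≤ t₁ + ε / 2 := min_le_right _ _
      linarith
    have h1 := hball hsd
    rw [Real.dist_eq, abs_lt] at h1
    have h2 := hafter₁ s ⟨hsgt, hst₂⟩
    linarith [h1.2]
  refine ⟨t₁, t₂, ht₁0, ht₁₂, ht₂T, hYt₁, hYt₂, fun s hs => ?_, fun s hs => ?_⟩
  · rcases eq_or_lt_of_le hs.2 with h | h
    · rw [h, hYt₂]
    · exact (hbefore₂ s ⟨hs.1, h⟩).le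
  · rcases eq_or_lt_of_le hs.1 with h | h
    · rw [← h, hYt₁]
    · exact (hafter₁ s ⟨h, hs.2⟩).le

/-! ### The logarithmic crossing integral -/

/-- **Along a crossing, the squared radial rate integrates to at least `log(‖Y t₂‖/‖Y t₁‖)²/T`.**  `Y` solves `Y′ = −W(Y)` (`W` continuous),
`‖Y‖ ≥ a > 0` on `[t₁, t₂]`, `t₂ − t₁ ≤ T`, `T > 0`, and `‖Y t₁‖ ≤ ‖Y t₂‖`.  With `f(t) := −⟪Y t, W(Y t)⟫/‖Y t‖²` one has `(log‖Y‖)′ = f` (FTC) and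
`f ≤ (λf² + λ⁻¹)/2`, so `log(‖Y t₂‖/‖Y t₁‖) · … ≤ …`: precisely `(log ‖Y t₂‖ − log ‖Y t₁‖)² ≤ T · ∫_{t₁}^{t₂} f²`. [folklore] -/
theorem sq_log_le_mul_integral_sq {Y : ℝ → EuclideanSpace ℝ (Fin 3)} {W : EuclideanSpace ℝ (Fin 3) → EuclideanSpace ℝ (Fin 3)}
    (hW : Continuous W) (hY : ∀ t, HasDerivAt Y ((-1 : ℝ) • W (Y t)) t) {t₁ t₂ a T : ℝ} (ht : t₁ ≤ t₂) (ha : 0 < a)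
    (hfar : ∀ s ∈ Icc t₁ t₂, a ≤ ‖Y s‖) (hT : t₂ - t₁ ≤ T) (hT0 : 0 < T) (hmono : ‖Y t₁‖ ≤ ‖Y t₂‖) :
    (Real.log ‖Y t₂‖ - Real.log ‖Y t₁‖) ^ 2 ≤
      T * ∫ s in t₁..t₂, (⟪Y s, W (Y s)⟫ / ‖Y s‖ ^ 2) ^ 2 := by
  have hYc : Continuous Y := continuous_iff_continuousAt.2 fun t => (hY t).continuousAt
  set f : ℝ → ℝ := fun s => -⟪Y s, W (Y s)⟫ / ‖Y s‖ ^ 2 with hf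
  have hpos : ∀ s ∈ Icc t₁ t₂, 0 < ‖Y s‖ := fun s hs => ha.trans_le (hfar s hs)
  -- `(log ‖Y‖)' = f` on `[t₁, t₂]`
  have hderiv : ∀ s ∈ uIcc t₁ t₂, HasDerivAt (fun σ => (1 / 2 : ℝ) * Real.log (‖Y σ‖ ^ 2)) (f s) s := by
    intro s hs
    rw [uIcc_of_le ht] at hs
    have h1 : HasDerivAt (fun σ => ‖Y σ‖ ^ 2) (2 * ⟪Y s, (-1 : ℝ) • W (Y s)⟫) s := (hY s).norm_sq
    have h2 := (h1.log (pow_pos (hpos s hs) 2).ne').const_mul (1 / 2 : ℝ)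
    have e : 1 / 2 * (2 * ⟪Y s, (-1 : ℝ) • W (Y s)⟫ / ‖Y s‖ ^ 2) = f s := by
      simp only [hf, inner_smul_right]
      field_simp
    exact h2.congr_deriv e
  have hfc : ContinuousOn f (uIcc t₁ t₂) := by
    rw [uIcc_of_le ht]
    have h1 : ContinuousOn (fun s => -⟪Y s, W (Y s)⟫) (Icc t₁ t₂) :=
      (hYc.inner (hW.comp hYc)).neg.continuousOn
    exact h1.div (hYc.norm.pow 2).continuousOn fun s hs => (pow_pos (hpos s hs) 2).ne'
  have hfi : IntervalIntegrable f volume t₁ t₂ := hfc.intervalIntegrable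
  have hFTC := intervalIntegral.integral_eq_sub_of_hasDerivAt hderiv hfi
  -- `∫ f = log ‖Y t₂‖ − log ‖Y t₁‖`
  have hlog : ∫ s in t₁..t₂, f s = Real.log ‖Y t₂‖ - Real.log ‖Y t₁‖ := by
    rw [hFTC]
    have e1 : ∀ x : ℝ, 0 < x → (1 / 2 : ℝ) * Real.log (x ^ 2) = Real.log x := fun x hx => by
      rw [Real.log_pow]; push_cast; ring
    rw [e1 _ (hpos t₂ ⟨ht, le_rfl⟩), e1 _ (hpos t₁ ⟨le_rfl, ht⟩)]
  set ℓ : ℝ := Real.log ‖Y t₂‖ - Real.log ‖Y t₁‖ with hℓ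
  have hℓ0 : 0 ≤ ℓ := by
    rw [hℓ]
    linarith [Real.log_le_log (hpos t₁ ⟨le_rfl, ht⟩) hmono]
  -- the square of the integrand is the same for `f` and `−f`
  have hsq : ∀ s, (⟪Y s, W (Y s)⟫ / ‖Y s‖ ^ 2) ^ 2 = f s ^ 2 := fun s => by
    simp only [hf]
    rw [neg_div, neg_sq]
  simp_rw [hsq]
  have hf2c : ContinuousOn (fun s => f s ^ 2) (uIcc t₁ t₂) := hfc.pow 2
  have hf2i : IntervalIntegrable (fun s => f s ^ 2) volume t₁ t₂ := hf2c.intervalIntegrable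
  have hI0 : 0 ≤ ∫ s in t₁..t₂, f s ^ 2 := intervalIntegral.integral_nonneg ht fun s _ => sq_nonneg _
  rcases eq_or_lt_of_le hℓ0 with hz | hℓpos
  · rw [← hz]; simp only [ne_eq, OfNat.ofNat_ne_zero, not_false_eq_true, zero_pow]; positivity
  -- AM–GM with `λ = T/ℓ`: `f ≤ (λ f² + λ⁻¹)/2`
  set lam : ℝ := T / ℓ with hlam
  have hlam0 : 0 < lam := div_pos hT0 hℓpos
  have hpt : ∀ s ∈ Icc t₁ t₂, f s ≤ lam / 2 * f s ^ 2 + 1 / (2 * lam) := by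
    intro s _
    have h1 : 0 ≤ (lam * f s - 1) ^ 2 := sq_nonneg _
    have h2 : lam / 2 * f s ^ 2 + 1 / (2 * lam) - f s = (lam * f s - 1) ^ 2 / (2 * lam) := by
      field_simp
      ring
    have h3 : 0 ≤ (lam * f s - 1) ^ 2 / (2 * lam) := by positivity
    linarith
  have hint : ∫ s in t₁..t₂, f s ≤ ∫ s in t₁..t₂, (lam / 2 * f s ^ 2 + 1 / (2 * lam)) :=
    intervalIntegral.integral_mono_on ht hfi ((hf2i.const_mul _).add intervalIntegrable_const) hpt
  rw [intervalIntegral.integral_add (hf2i.const_mul _) intervalIntegrable_const, intervalIntegral.integral_const_mul,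
    intervalIntegral.integral_const, smul_eq_mul, hlog] at hint
  -- `ℓ ≤ (T/ℓ)/2 ∫f² + (t₂−t₁) ℓ/(2T) ≤ (T/ℓ)/2 ∫f² + ℓ/2`
  have h4 : (t₂ - t₁) * (1 / (2 * lam)) ≤ ℓ / 2 := by
    rw [hlam]
    have : (t₂ - t₁) * (1 / (2 * (T / ℓ))) = (t₂ - t₁) / T * (ℓ / 2) := by field_simp
    rw [this]
    have h5 : (t₂ - t₁) / T ≤ 1 := by rw [div_le_one hT0]; exact hT
    nlinarith
  have h6 : ℓ / 2 ≤ T / ℓ / 2 * ∫ s in t₁..t₂, f s ^ 2 := by rw [hlam] at hint; linarith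
  have h7 : ℓ * ℓ ≤ T * ∫ s in t₁..t₂, f s ^ 2 := by
    have := mul_le_mul_of_nonneg_left h6 (by linarith : (0 : ℝ) ≤ 2 * ℓ)
    have e : 2 * ℓ * (T / ℓ / 2 * ∫ s in t₁..t₂, f s ^ 2) = T * ∫ s in t₁..t₂, f s ^ 2 := by
      field_simp
    rw [e] at this
    linarith
  rw [sq]
  exact h7

/-! ### The «stay set» is closed -/

variable {γ : ℝ} {V : EuclideanSpace ℝ (Fin 3) → EuclideanSpace ℝ (Fin 3)}

/-- **The set of `(t, y)` whose backward orbit stays in the closed ball of radius `b` on `[0, t]` is closed** (`V ∈ C²`, `‖DV‖ ≤ K`; joint continuity of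
the flow, `C2.Kelvin.contDiff_flow_uncurry`). [folklore] -/
theorem isClosed_backwardStaySet (hV : ContDiff ℝ 2 V) {K : ℝ} (hK : ∀ y : EuclideanSpace ℝ (Fin 3), ‖fderiv ℝ V y‖ ≤ K) (b : ℝ) :
    IsClosed {p : ℝ × EuclideanSpace ℝ (Fin 3) | 0 ≤ p.1 ∧
      ∀ σ ∈ Icc 0 p.1, ‖ODE.evolutionMap (fun _ : ℝ => selfSimilarTransport γ 0 V) 0 (-σ) p.2‖ ≤ b} := by
  set Φ := ODE.evolutionMap (fun _ : ℝ => selfSimilarTransport γ 0 V) 0 with hΦ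
  have hjc : Continuous fun q : ℝ × EuclideanSpace ℝ (Fin 3) => Φ (-q.1) q.2 := by
    have h1 := (C2.Kelvin.contDiff_flow_uncurry (γ := γ) hV hK).continuous
    exact h1.comp (continuous_fst.neg.prodMk continuous_snd)
  rw [← isOpen_compl_iff, Metric.isOpen_iff]
  rintro ⟨t₀, y₀⟩ hp₀
  simp only [mem_compl_iff, mem_setOf_eq, not_and, not_forall, exists_prop] at hp₀
  by_cases ht₀ : t₀ < 0
  · refine ⟨-t₀, by linarith, fun p hp => ?_⟩
    simp only [mem_compl_iff, mem_setOf_eq, not_and]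
    intro hp1
    exfalso
    have hpd : dist p (t₀, y₀) < -t₀ := hp
    rw [Prod.dist_eq, max_lt_iff] at hpd
    have h1 := hpd.1
    rw [Real.dist_eq, abs_lt] at h1
    linarith
  · push Not at ht₀
    obtain ⟨σ₀, hσ₀, hgt⟩ := hp₀ ht₀
    rw [not_le] at hgt
    -- joint continuity at `(σ₀, y₀)`
    have hO : IsOpen {q : ℝ × EuclideanSpace ℝ (Fin 3) | b < ‖Φ (-q.1) q.2‖} := isOpen_lt continuous_const hjc.norm
    obtain ⟨ε, hε, hball⟩ := Metric.isOpen_iff.1 hO (σ₀, y₀) hgt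
    refine ⟨ε, hε, fun p hp => ?_⟩
    have hpd : dist p (t₀, y₀) < ε := hp
    rw [Prod.dist_eq, max_lt_iff] at hpd
    simp only [mem_compl_iff, mem_setOf_eq, not_and, not_forall, exists_prop]
    intro hp1
    refine ⟨min σ₀ p.1, ⟨le_min hσ₀.1 hp1, min_le_right _ _⟩, ?_⟩
    rw [not_le]
    have hmem : (min σ₀ p.1, p.2) ∈ Metric.ball (σ₀, y₀) ε := by
      rw [Metric.mem_ball, Prod.dist_eq, max_lt_iff]
      refine ⟨?_, hpd.2⟩
      rw [Real.dist_eq]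
      have h1 : dist p.1 t₀ < ε := hpd.1
      rw [Real.dist_eq, abs_lt] at h1
      rcases le_or_gt σ₀ p.1 with h | h
      · rw [min_eq_left h, sub_self, abs_zero]; exact hε
      · rw [min_eq_right h.le, abs_lt]
        constructor <;> linarith [hσ₀.2]
    have h3 := hball hmem
    simpa only [mem_setOf_eq] using h3

/-! ### The backward flow pulls Lebesgue measure back with the constant Jacobian -/

/-- **Change of variables along orbits that stay.**  `Ṽ ∈ C²` (`‖DṼ‖ ≤ K`) divergence-free on `‖z‖ ≤ R`, `Φ` the flow of `γz + Ṽ z`, `t ≥ 0`, `D` measurable with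
`‖Φ_{−σ} y‖ ≤ R` for all `y ∈ D`, `σ ∈ [0,t]`.  Then for every `g ≥ 0`: `∫_D g(Φ_{−t} y) dy = e^{3γt} ∫_{Φ_t⁻¹ D} g(z) dz` (area formula for `Φ_t` on `Φ_t⁻¹ D`
with `det DΦ_t ≡ e^{3γt}` there, `BernoulliLandscape.det_fderiv_flow_eq_exp_of_stay`). [cite: ConstantinIgnatovaVicol2026Putative, §3.4.1 eq. (3.22)] -/
theorem lintegral_comp_backwardFlow_eq_of_stay (hV : ContDiff ℝ 2 V) {K : ℝ} (hK : ∀ y : EuclideanSpace ℝ (Fin 3), ‖fderiv ℝ V y‖ ≤ K)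
    {R t : ℝ} (ht : 0 ≤ t) (hdiv : ∀ z : EuclideanSpace ℝ (Fin 3), ‖z‖ ≤ R → VectorCalculus.divergence V z = 0)
    {D : Set (EuclideanSpace ℝ (Fin 3))} (hDm : MeasurableSet D)
    (hstay : ∀ y ∈ D, ∀ σ ∈ Icc 0 t, ‖ODE.evolutionMap (fun _ : ℝ => selfSimilarTransport γ 0 V) 0 (-σ) y‖ ≤ R)
    (g : EuclideanSpace ℝ (Fin 3) → ℝ≥0∞) :
    ∫⁻ y in D, g (ODE.evolutionMap (fun _ : ℝ => selfSimilarTransport γ 0 V) 0 (-t) y) =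
      ENNReal.ofReal (Real.exp (3 * γ * t)) *
        ∫⁻ z in ODE.evolutionMap (fun _ : ℝ => selfSimilarTransport γ 0 V) 0 t ⁻¹' D, g z := by
  set Φ := ODE.evolutionMap (fun _ : ℝ => selfSimilarTransport γ 0 V) 0 with hΦ
  have hV1 : ContDiff ℝ 1 V := hV.of_le (by norm_num)
  have hflow_add : ∀ (s s' : ℝ) (y : EuclideanSpace ℝ (Fin 3)), Φ (s + s') y = Φ s (Φ s' y) :=
    fun s s' y => C2.Kelvin.flow_add (γ := γ) hV1 hK s s' y
  have hΦinv : ∀ y, Φ t (Φ (-t) y) = y := by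
    intro y
    have h1 := hflow_add t (-t) y
    rw [add_neg_cancel] at h1
    rw [← h1]; exact ODE.evolutionMap_self _ 0 y
  have hΦinv' : ∀ z, Φ (-t) (Φ t z) = z := by
    intro z
    have h1 := hflow_add (-t) t z
    rw [neg_add_cancel] at h1
    rw [← h1]; exact ODE.evolutionMap_self _ 0 z
  set S : Set (EuclideanSpace ℝ (Fin 3)) := Φ t ⁻¹' D with hS
  have hΦtc : Continuous (Φ t) := (C2.Kelvin.contDiff_flow (γ := γ) hV hK t).continuous
  have hSm : MeasurableSet S := hΦtc.measurable hDm
  have himage : Φ t '' S = D := by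
    ext y
    constructor
    · rintro ⟨z, hz, rfl⟩; exact hz
    · intro hy; exact ⟨Φ (-t) y, by show Φ t (Φ (-t) y) ∈ D; rw [hΦinv y]; exact hy, hΦinv y⟩
  have hL := C2.Kelvin.isUniformlyLipschitzOn_transport (γ := γ) hV1 hK
  have hdiff : ∀ x ∈ S, HasFDerivWithinAt (Φ t) (fderiv ℝ (Φ t) x) S x := fun x _ =>
    (((C2.Kelvin.contDiff_flow (γ := γ) hV hK t).differentiable (by norm_num)) x).hasFDerivAt.hasFDerivWithinAt
  have hinj : InjOn (Φ t) S := (hL.bijective_evolutionMap convex_univ (mem_univ _) (mem_univ _)).injective.injOn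
  -- the forward orbits of `S` stay in the ball on `[0, t]`
  have hstayS : ∀ z ∈ S, ∀ σ ∈ Icc 0 t, ‖Φ σ z‖ ≤ R := by
    intro z hz σ hσ
    have h1 : Φ σ z = Φ (-(t - σ)) (Φ t z) := by
      rw [← hflow_add (-(t - σ)) t z]; congr 1; ring
    rw [h1]
    exact hstay (Φ t z) hz (t - σ) ⟨by linarith [hσ.2], by linarith [hσ.1]⟩
  have hdet : ∀ z ∈ S, ENNReal.ofReal |(fderiv ℝ (Φ t) z).det| = ENNReal.ofReal (Real.exp (3 * γ * t)) := by
    intro z hz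
    rw [det_fderiv_flow_eq_exp_of_stay (γ := γ) hV hK ht hdiv z (hstayS z hz), abs_of_pos (Real.exp_pos _)]
  calc ∫⁻ y in D, g (Φ (-t) y) = ∫⁻ y in Φ t '' S, g (Φ (-t) y) := by rw [himage]
    _ = ∫⁻ z in S, ENNReal.ofReal |(fderiv ℝ (Φ t) z).det| * g (Φ (-t) (Φ t z)) :=
        lintegral_image_eq_lintegral_abs_det_fderiv_mul volume hSm hdiff hinj _
    _ = ∫⁻ z in S, ENNReal.ofReal (Real.exp (3 * γ * t)) * g z := by
        refine setLIntegral_congr_fun hSm (fun z hz => ?_)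
        rw [hdet z hz, hΦinv' z]
    _ = ENNReal.ofReal (Real.exp (3 * γ * t)) * ∫⁻ z in S, g z := lintegral_const_mul' _ _ ENNReal.ofReal_ne_top

end Summit.NavierStokesRegularity.NavierStokesRegularity.Theorems.PowerGaugeEulerLiouville.Loc

end
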